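import Literature.NumberTheory.GaloisRepresentations.GlobalReciprocityExistenceProofs
import HarnessLib

/-!
# A quadratic idele class character is the class-field character of a quadratic extension
# (proof file)

Topic `NumberTheory/Automorphic`; namespace `Literature.NumberTheory.Automorphic`. Proof file
(theorems only: no definition, no named fact, no instance, no `sorry`).

**The statement** (`HeckeCharacter.exists_isClassFieldCharacter_of_sq_eq_one`). Let `δ ≠ 1` be an
idele class character of the number field `F` with `δ² = 1`. Then there is a quadratic extension
`K/F` (realised inside the algebraic closure `F̄`) such that `δ` is *the* class-field character of
`K/F`: `δ(x) = 1 ↔ x ∈ F^× N_{K/F}(𝔸_K^×)` (`HeckeCharacter.IsClassFieldCharacter`, the character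
`η` of Arthur–Clozel 1989, Ch. 3 §4, "vanishing exactly on `F^* N(𝔸_E^*)`"). This is the existence
theorem of class field theory for quadratic characters (Tate, Cassels–Fröhlich Ch. VII §5.1, Main
Theorem (B) with the existence theorem (D): the open subgroups of finite index of `C_F` are the norm
groups; for index `2`, `K = F(√θ)`).

It is the dictionary used in the dihedral case of D. Ramakrishnan, *Modularity of the
Rankin–Selberg `L`-series, and multiplicity one for `SL(2)`*, Ann. of Math. 152 (2000), §4.1
(proof of Thm. 4.1.2) and Prop. 2.3.1 (2): a cuspidal `π` on `GL(2)/F` with `π ≃ π ⊗ δ`, `δ ≠ 1`,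
has `δ` quadratic, "hence of the form `χ_{K/F}`", and `π` is then automorphically induced from `K`.

**Proof** (all inputs are theorems of the tree). By the existence theorem in character form
(`galoisHecke_of_keyLemma` with the Key Lemma `exists_cyclic_charHecke_of_pow_prime_eq_one` and
`artinReciprocity_character_holds`: Tate, Cassels–Fröhlich VII §12), `δ = ω_χ = χ ∘ ψ_{L|F}` for a
character `χ` of the group of a finite abelian `L ⊆ F̄`; passing to the fixed field of the kernel
of `χ ∘ r_L` (the argument of `exists_inflateCharacter_eq`, redone here keeping the injectivity of
the descended character: `exists_injective_inflateCharacter_eq`) we may take `χ` injective. Then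
`χ² = 1` (as `δ² = 1` and `ψ_{L|F}` is onto, `artinIdeleMap_surjective`) and `χ ≠ 1`, so `G(L|F)`
embeds in `{±1}` and is not trivial: `[L : F] = 2`; and
`δ(x) = 1 ↔ ψ_{L|F}(x) = 1 ↔ x ∈ F^× N_{L|F} 𝕀_L` (`ker_artinIdeleMap_eq_normGroup_of_character`,
Tate 5.1 (B)).

## References

* J. Tate, *Global class field theory*, Ch. VII in Cassels–Fröhlich, *Algebraic Number Theory*
  (1967), §5.1 Main Theorem (B), (D), §12. [CasselsFrohlichANT1967]
* J. Arthur, L. Clozel, *Simple algebras, base change, and the advanced theory of the trace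
  formula*, Ann. of Math. Stud. 120 (1989), Ch. 3 §4 (the character `η`). [ArthurClozelAMS120]
* D. Ramakrishnan, *Modularity of the Rankin–Selberg `L`-series, and multiplicity one for `SL(2)`*,
  Ann. of Math. (2) 152 (2000), 45–111, Prop. 2.3.1 (2) and §4.1. [Ramakrishnan2000]
-/

noncomputable section

open scoped NumberField
open NumberField IsDedekindDomain Filter Field

namespace Literature.NumberTheory.Automorphic

open Literature.NumberTheory.GaloisRepresentations

universe u

section Inflate

variable {K : Type u} [Field K] [NumberField K]

/-- **Every rank-one Artin representation is inflated from an injective character** of the group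
of the finite (abelian) extension cut out by its kernel: for `ρ : Γ_K → GL_1(ℂ)`, with
`L = K̄^{ker ρ}`, `ρ = χ ∘ r_L` for an *injective* character `χ` of `G(L|K)`. This is
`exists_inflateCharacter_eq` of `GlobalReciprocityCharacterFormProofs` with the injectivity of `χ`
(established in its proof) kept in the conclusion. [cite: NeukirchANT1999, Ch. VII §10 Thm. (10.6) (proof)] -/
theorem exists_injective_inflateCharacter_eq (ρ : FramedArtinRep K 1) :
    ∃ (L : IntermediateField K (AlgebraicClosure K)) (_ : FiniteDimensional K L)
      (_ : IsAbelianGalois K L) (χ : (L ≃ₐ[K] L) →* ℂˣ),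
      Function.Injective χ ∧ inflateCharacter L χ = ρ := by
  classical
  -- the finite Galois extension `L = K̄^{ker ρ}`
  set N : Subgroup (absoluteGaloisGroup K) := ρ.toMonoidHom.ker with hNdef
  have hker : IsOpen (N : Set (absoluteGaloisGroup K)) := FramedArtinRep.isOpen_ker_toMonoidHom ρ
  set L : IntermediateField K (AlgebraicClosure K) := IntermediateField.fixedField N with hLdef
  have hLN : L.fixingSubgroup = N := fixingSubgroup_fixedField_of_isOpen N hker
  haveI : FiniteDimensional K L := finiteDimensional_fixedField_of_isOpen N hker
  haveI : IsGalois K L := by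
    rw [← InfiniteGalois.normal_iff_isGalois, hLN, hNdef]
    exact MonoidHom.normal_ker _
  -- the restriction `r_L : Γ_K → G(L|K)`: kernel `= ker ρ`, surjective
  have hr : ∀ (γ : absoluteGaloisGroup K) (x : L),
      ((absRestrictNormalHom L γ x : L) : AlgebraicClosure K) = γ • (x : AlgebraicClosure K) :=
    fun γ x => AlgEquiv.restrictNormalHom_apply L _ x
  have hrker : ∀ γ : absoluteGaloisGroup K, absRestrictNormalHom L γ = 1 ↔ ρ γ = 1 := by
    intro γ
    have key : absRestrictNormalHom L γ = 1 ↔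
        γ ∈ (L.fixingSubgroup : Subgroup (absoluteGaloisGroup K)) := by
      rw [mem_fixingSubgroup_iff_forall_smul]
      constructor
      · intro h1 x
        rw [← hr γ x, h1, AlgEquiv.one_apply]
      · intro h1
        ext x
        rw [hr γ x, AlgEquiv.one_apply]
        exact h1 x
    rw [key, hLN]
    exact MonoidHom.mem_ker
  have hrsurj : Function.Surjective (absRestrictNormalHom L) := absRestrictNormalHom_surjective L
  -- the character `χ` of `G(L|K)` with `χ ∘ r_L = e⁻¹ ∘ ρ`, `e : ℂˣ ≃ GL_1(ℂ)`
  set e : ℂˣ ≃ₜ* GL (Fin 1) ℂ := FramedRep.unitsContinuousMulEquivOfUnique (Fin 1) ℂ with hedef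
  set f : absoluteGaloisGroup K →* ℂˣ := e.symm.toMulEquiv.toMonoidHom.comp ρ.toMonoidHom
    with hfdef
  have hf : ∀ γ : absoluteGaloisGroup K, f γ = e.symm (ρ γ) := fun γ => rfl
  have hkerle : (absRestrictNormalHom L).ker ≤ f.ker := by
    intro γ hγ
    rw [MonoidHom.mem_ker] at hγ ⊢
    rw [hf, (hrker γ).mp hγ, map_one]
  set χ : (L ≃ₐ[K] L) →* ℂˣ := (absRestrictNormalHom L).liftOfSurjective hrsurj ⟨f, hkerle⟩
    with hχdef
  have hχr : ∀ γ : absoluteGaloisGroup K, χ (absRestrictNormalHom L γ) = f γ := fun γ =>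
    (absRestrictNormalHom L).liftOfRightInverse_comp_apply _ _ _ γ
  have heρ : ∀ γ : absoluteGaloisGroup K, e (f γ) = ρ γ := fun γ => by
    rw [hf]
    exact e.apply_symm_apply (ρ γ)
  -- `χ` is injective, so `G(L|K)` is commutative
  have hχinj : Function.Injective χ := by
    rw [← MonoidHom.ker_eq_bot_iff, Subgroup.eq_bot_iff_forall]
    intro g hg
    obtain ⟨γ, rfl⟩ := hrsurj g
    rw [MonoidHom.mem_ker, hχr] at hg
    have h2 : ρ γ = 1 := by rw [← heρ γ, hg, map_one]
    exact (hrker γ).mpr h2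
  haveI hab : IsAbelianGalois K L :=
    { is_comm := ⟨fun s t => hχinj (by rw [map_mul, map_mul, mul_comm])⟩ }
  refine ⟨L, inferInstance, hab, χ, hχinj, DFunLike.ext _ _ fun γ => ?_⟩
  rw [inflateCharacter_apply, hχr]
  exact heρ γ

end Inflate

section Quadratic

variable {F : Type} [Field F] [NumberField F]

/-- A unit of `ℂ` with `z² = 1`, `z ≠ 1` is `-1`. [folklore] -/
private theorem units_eq_neg_one_of_sq {z : ℂˣ} (h2 : z ^ 2 = 1) (h1 : z ≠ 1) : z = -1 := by
  have h : (z : ℂ) ^ 2 = 1 := by rw [← Units.val_pow_eq_pow_val, h2, Units.val_one]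
  rcases sq_eq_one_iff.mp h with h' | h'
  · exact absurd (Units.val_eq_one.mp h') h1
  · exact Units.ext (by rw [h', Units.val_neg, Units.val_one])

/-- **A finite-order idele class character is a Galois character with injective character datum**:
`δ = ω_χ` for an injective character `χ` of the group of a finite abelian `L ⊆ F̄` (the existence
theorem in character form, `galoisHecke_of_keyLemma` + `exists_cyclic_charHecke_of_pow_prime_eq_one`,
followed by the descent `exists_injective_inflateCharacter_eq`). [cite: CasselsFrohlichANT1967, Ch. VII §12 (Proof of the Theorem)] -/
theorem HeckeCharacter.exists_injective_charHecke_eq {δ : HeckeCharacter F} (hδ : δ.IsFiniteOrder) :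
    ∃ (L : IntermediateField F (AlgebraicClosure F)) (_ : FiniteDimensional F L)
      (_ : IsAbelianGalois F L) (χ : (L ≃ₐ[F] L) →* ℂˣ),
      Function.Injective χ ∧ δ = charHecke L χ artinReciprocity_character_holds := by
  obtain ⟨L₀, _, _, χ₀, h₀⟩ := galoisHecke_of_keyLemma artinReciprocity_character_holds
    exists_cyclic_charHecke_of_pow_prime_eq_one (orderOf δ) F δ rfl hδ
  obtain ⟨L, _, _, χ, hinj, hinfl⟩ := exists_injective_inflateCharacter_eq (inflateCharacter L₀ χ₀)
  refine ⟨L, inferInstance, inferInstance, χ, hinj, ?_⟩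
  rw [h₀]
  change heckeOfArtinCharacter _ (inflateCharacter L₀ χ₀) =
    heckeOfArtinCharacter _ (inflateCharacter L χ)
  rw [hinfl]

/-- **A quadratic idele class character is the class-field character of a quadratic extension**
(class field theory: existence theorem for index `2`; Tate, Cassels–Fröhlich Ch. VII §5.1 (B), (D)).
For `δ ≠ 1` with `δ² = 1` there is a finite abelian `K ⊆ F̄` with `[K : F] = 2` and
`δ(x) = 1 ↔ x ∈ F^× N_{K/F}(𝔸_K^×)` (`HeckeCharacter.IsClassFieldCharacter`). This is the "`χ`
quadratic, hence `χ = χ_{K/F}`" of Ramakrishnan 2000, Prop. 2.3.1 (2) / §4.1.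
[cite: CasselsFrohlichANT1967, Ch. VII §5.1 Main Theorem (B), (D)] [cite: Ramakrishnan2000, Prop. 2.3.1 (2)] -/
theorem HeckeCharacter.exists_isClassFieldCharacter_of_sq_eq_one {δ : HeckeCharacter F}
    (h2 : δ ^ 2 = 1) (h1 : δ ≠ 1) :
    ∃ (K : IntermediateField F (AlgebraicClosure F)) (_ : FiniteDimensional F K)
      (_ : IsAbelianGalois F K) (_ : NumberField K),
      Module.finrank F K = 2 ∧ δ.IsClassFieldCharacter K := by
  classical
  have hfo : δ.IsFiniteOrder := isOfFinOrder_iff_pow_eq_one.mpr ⟨2, two_pos, h2⟩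
  obtain ⟨L, _, _, χ, hinj, hδ⟩ := HeckeCharacter.exists_injective_charHecke_eq hfo
  haveI : NumberField L := NumberField.of_module_finite F L
  set hR := artinReciprocity_character_holds
  have hsurj := artinIdeleMap_surjective L hR
  -- `χ² = 1` and `χ ≠ 1`
  have hχ2 : ∀ g : L ≃ₐ[F] L, χ g ^ 2 = 1 := by
    intro g
    obtain ⟨x, rfl⟩ := hsurj g
    rw [apply_artinIdeleMap, ← HeckeCharacter.pow_apply, ← hδ, h2, HeckeCharacter.one_apply]
  have hχ1 : ∃ g : L ≃ₐ[F] L, χ g ≠ 1 := by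
    by_contra! hall
    apply h1
    rw [hδ]
    refine HeckeCharacter.ext fun x => ?_
    rw [← apply_artinIdeleMap, hall, HeckeCharacter.one_apply]
  obtain ⟨g₀, hg₀⟩ := hχ1
  -- `G(L|F) = {1, g₀}`
  have hcard : Nat.card (L ≃ₐ[F] L) = 2 := by
    rw [Nat.card_eq_two_iff]
    refine ⟨1, g₀, fun h => hg₀ (by rw [← h, map_one]), Set.eq_univ_of_forall fun g => ?_⟩
    by_cases hg : χ g = 1
    · exact Or.inl (hinj (by rw [hg, map_one])).symm
    · refine Or.inr (hinj ?_)
      rw [units_eq_neg_one_of_sq (hχ2 g) hg, units_eq_neg_one_of_sq (hχ2 g₀) hg₀]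
  refine ⟨L, inferInstance, inferInstance, inferInstance, ?_, fun x => ?_⟩
  · rw [← IsGalois.card_aut_eq_finrank]
    exact hcard
  · rw [← ker_artinIdeleMap_eq_normGroup_of_character F hR L, MonoidHom.mem_ker, hδ,
      ← apply_artinIdeleMap, map_eq_one_iff χ hinj]

end Quadratic

end Literature.NumberTheory.Automorphic

end
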